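import Mathlib.Analysis.SpecialFunctions.Pow.Real
import Literature.Computability.MetaComplexity.Magnification
import Literature.Computability.MetaComplexity.MCSP
import Literature.Computability.Complexity.Promise
import HarnessLib

/-!
# Named facts: the formula-size lower-bound side of the hardness-magnification frontiers B and C
(Chen–Hirahara–Oliveira–Pich–Rajgopal–Santhanam, arXiv:1911.08297, §1.1, items B4 and C4)

Trunk T-CPLX-META; cite item `wi-03790` (route PneNP/Circuit crux #5), the part statable over
the tree today: `gapMCSP a b` (`MCSP.lean`, = CHOPRS's promise problem `MCSP[s, t]`: YES =
truth tables of circuit complexity `≤ s`, NO = truth tables hard for size `t`), `promiseLift`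
(`Promise.lean`) and `FORMULA s` (`Magnification.lean`).

CHOPRS §1.1 (N = 2ⁿ the input length):
* **B4.** `MCSP[2^{n^{1/3}}, 2^{n^{2/3}}] ∉ Formula[N^{1.99}]` ([HS17]; see also [OPS19]).
* **C4.** `MCSP[2^{n^{1/2}}/10n, 2^{n^{1/2}}] ∉ Formula[N^{1.99}]` ([HS17]; see also [OPS19]).
(The MAGNIFICATION sides B1/C1/D1 and frontier A need Formula-XOR, almost-formulas,
GapAND-formulas, `AC⁰`-XOR — not in the tree; the locality barrier, Thm. 2, needs local-oracle
circuits. Left to definition items.)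

Faithfulness of the rendering. `Formula[s]` in CHOPRS bounds the number of LEAVES; the tree's
`FORMULA s` bounds `Circuit.size` (gates, `¬` included). A De Morgan formula with `≤ s` gates has
`≤ s + 1` leaves, so `FORMULA (⌊N^{1.99}⌋ - 1) ⊆ Formula[N^{1.99}]` and the facts below (stated for
that class) are IMPLIED by the printed ones. Likewise the real thresholds are rounded in the safe
directions: YES-bound rounded UP (`⌈·⌉`), NO-bound rounded DOWN (`⌊·⌋`) — a promise problem with
more YES and more NO instances is harder, so its lower bound is weaker. Nothing is asserted.

## References

* L. Chen, S. Hirahara, I. C. Oliveira, J. Pich, N. Rajgopal, R. Santhanam, arXiv:1911.08297,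
  §1.1, HM Frontiers B (item B4) and C (item C4).
* S. Hirahara, R. Santhanam, *On the average-case complexity of MCSP and its variants*, CCC 2017
  ([HS17]); I. C. Oliveira, J. Pich, R. Santhanam, CCC 2019 ([OPS19]).
-/

noncomputable section

open Literature.Computability.Complexity

namespace Literature.Computability.MetaComplexity

/-- The formula-size class of the frontiers: De Morgan formulas with at most `⌊N^{1.99}⌋ - 1`
gates (hence at most `N^{1.99}` leaves). [CHOPRS 2019, §1.1 (`Formula[N^{1.99}]`)] [cite: arXiv191108297, §1.1] -/
def frontierFormulaClass : Set (Language Bool) :=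
  FORMULA fun N => ⌊(N : ℝ) ^ (1.99 : ℝ)⌋₊ - 1

/-- NAMED FACT (**CHOPRS 2019, §1.1, HM Frontier C, item C4**, after Hirahara–Santhanam 2017 and
Oliveira–Pich–Santhanam 2019): the promise problem `MCSP[2^{√n}/10n, 2^{√n}]` (`N = 2ⁿ`) is not
solved by De Morgan formulas of leaf-size `N^{1.99}`: no language in the class separates its YES
from its NO instances (`promiseLift`). Thresholds rounded in the safe directions (module doc).
Users take `(h : chop_frontierC4)`. [CHOPRS 2019, §1.1 C4; HS17; OPS19] [cite: arXiv191108297, §1.1 (C4)] -/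
def chop_frontierC4 : Prop :=
  gapMCSP (fun n => ⌈(2 : ℝ) ^ Real.sqrt n / (10 * n)⌉₊) (fun n => ⌊(2 : ℝ) ^ Real.sqrt n⌋₊) ∉
    promiseLift frontierFormulaClass

/-- NAMED FACT (**CHOPRS 2019, §1.1, HM Frontier B, item B4**, after HS17 / OPS19): the promise
problem `MCSP[2^{n^{1/3}}, 2^{n^{2/3}}]` is not solved by De Morgan formulas of leaf-size `N^{1.99}`.
Users take `(h : chop_frontierB4)`. [CHOPRS 2019, §1.1 B4; HS17; OPS19] [cite: arXiv191108297, §1.1 (B4)] -/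
def chop_frontierB4 : Prop :=
  gapMCSP (fun n => ⌈(2 : ℝ) ^ ((n : ℝ) ^ (1 / 3 : ℝ))⌉₊)
      (fun n => ⌊(2 : ℝ) ^ ((n : ℝ) ^ (2 / 3 : ℝ))⌋₊) ∉
    promiseLift frontierFormulaClass

/-! ### API -/

/-- Unfolding `frontierFormulaClass`. [folklore] -/
theorem frontierFormulaClass_eq :
    frontierFormulaClass = FORMULA fun N => ⌊(N : ℝ) ^ (1.99 : ℝ)⌋₊ - 1 := rfl

/-- The frontier class is contained in `FORMULA ⌊N^{1.99}⌋` (monotonicity), the form in which a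
route may prefer to consume the lower bound. [folklore] -/
theorem frontierFormulaClass_subset :
    frontierFormulaClass ⊆ FORMULA fun N => ⌊(N : ℝ) ^ (1.99 : ℝ)⌋₊ :=
  FORMULA_mono fun _ => Nat.sub_le _ _

/-- Consequence shape: under C4, any language separating the C4 promise problem lies outside the
frontier formula class. [CHOPRS 2019, §1.1] [folklore] -/
theorem not_mem_frontierFormulaClass_of_separates (h : chop_frontierC4) {L : Language Bool}
    (hyes : (gapMCSP (fun n => ⌈(2 : ℝ) ^ Real.sqrt n / (10 * n)⌉₊)
      (fun n => ⌊(2 : ℝ) ^ Real.sqrt n⌋₊)).yes ≤ L)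
    (hno : (gapMCSP (fun n => ⌈(2 : ℝ) ^ Real.sqrt n / (10 * n)⌉₊)
      (fun n => ⌊(2 : ℝ) ^ Real.sqrt n⌋₊)).no ≤ Lᶜ) :
    L ∉ frontierFormulaClass := fun hL =>
  h ⟨L, hL, hyes, hno⟩

end Literature.Computability.MetaComplexity
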